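import Literature.NumberTheory.ConnesConsani2021.WindowOperatorCompact
import Literature.Analysis.SpecialFunctions.LegendrePolynomials
import Literature.Analysis.OperatorTheory.IntegralOperatorHilbertSchmidt
import Mathlib.Analysis.InnerProductSpace.LinearMap
import HarnessLib

/-!
# Connes–Consani 2021 §6, the spectral certificate — SOUNDNESS LEMMAS (generic, no numerics)

LABEL (line 1): RH-FREE.  Generic functional analysis about ONE bounded operator on the Hilbert space
`𝓗 = L²([a, b], dx)`: a compression-gap inequality, finite-rank operators on a finite family of
vectors and their coordinates, the rescaled Legendre family in `𝓗`, and the Hilbert–Schmidt bound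
for the operator of a kernel form.  Nothing here mentions `ζ`, its zeros, or RH; nothing here bears
on the truth of RH.  No number of Connes–Consani's §6 enters: every numerical input of the §6
"computer calculation" (Fact 6.1 `ε₁ ≃ 0.00122`, Lemma 6.4 `λ = 1.05158`, Fact 6.5
`⟨η₀|η⟩ ≃ 0.94865`, Lemma 6.8 (iii) `λ₂ ≤ 0.772216`; A. Connes, C. Consani, *Weil positivity and trace
formula, the archimedean place*, Selecta Math. (N.S.) 27 (2021) 77 = arXiv:2006.13771, §6 pp. 22–29
[bib: `ConnesConsani2021`]) stays OUTSIDE this file.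

## Role (cell `rh-crit`, sub-cell cc, `cc/ENGINE-SPEC-C.md` §2 "Lean side", row C-SOUND)

The obligation of record for apex input (C) of `WeilArchPositivity_soninTrace_fine` is the sign-free
operator inequality `hpos` of `MainInequalityAssembly.weilArchPositivity_soninTrace_fine_of_opIneq`:
`∀ ξ, 0 ≤ re⟪ξ, ξ − 𝐊_I ξ⟫ + a₀ |⟪η₀, ξ⟫|²` on `L²(I)`, `I = [−½ log 2, ½ log 2]`, `𝐊_I = windowOp ϖ`
(Prop. 5.5 (ii), `KernelApproximation.lean`), `η₀ = constVector` (§6.7).  In print it follows from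
Lemma 6.10's spectral data of a finite-rank `T` with `‖𝐊_I − T‖ ≤ ε₁` (tree:
`opIneq_of_rankOne_decomposition`).  The certificate route of the spec replaces the printed `T`
(1732 non-harmonic modes) by a LOW-RANK Galerkin approximant `T = Σ_{i,j ≤ N} t_ij |p_i⟩⟨p_j|` on the
rescaled Legendre polynomials and bounds `‖𝐊_I − T‖` by the HILBERT–SCHMIDT norm of the kernel
difference.  This file supplies the algebraic half of the generic lemmas that make such a certificate sound:

* **(S2) `opIneq_of_compression_gap`** (abstract Hilbert space): if `T` vanishes on `V^⊥` and maps
  into `V`, `η₀ ∈ V`, the compressed pencil has a gap `μ` on `V`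
  (`μ‖v‖² ≤ re⟪v, v − Tv⟫ + a₀|⟪η₀, v⟫|²` for `v ∈ V`) and `‖K − T‖ ≤ δ ≤ min(1, μ)`, then
  `0 ≤ re⟪ξ, ξ − Kξ⟫ + a₀|⟪η₀, ξ⟫|²` for every `ξ` (pattern of Lemma 6.10's deduction,
  `RankOnePositivity.re_inner_sub_ge_of_rankOne_decomposition`), with the margin form
  `re_inner_sub_add_ge_of_compression_gap`.
* **Finite-rank operators on a finite family** `finRankOp p t = Σ t_ij |p_i⟩⟨p_j|`
  (Mathlib's `InnerProductSpace.rankOne`): range in `span p`, vanishing on `(span p)^⊥`, matrix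
  coefficients, and the gap hypothesis of (S2) IN COORDINATES (`gap_of_coords`: a quadratic-form
  inequality in the Gram matrix `Γ_ij = ⟪p_i, p_j⟫`, `t` and the coordinates of `η₀`), with the
  reduction from complex to real coordinates for real data (`coordsGap_of_real`).
* **(S3) the Legendre window family** `legendreWindowVec a b i` = the class of
  `x ↦ P_i((2x − a − b)/(b − a))` in `L²([a, b])` (the tree's Rodrigues `legendre`,
  `Literature.Analysis.SpecialFunctions`): Gram matrix `diag((b − a)/(2i+1))`
  (`inner_legendreWindowVec`, from the tree's `integral_legendre_mul_legendre_eq_zero`,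
  `integral_legendre_sq`) and `constVector a b = (b − a)^{-1/2} • legendreWindowVec a b 0`.
* the Legendre window data for the certificate: the family `legendreWindowFamily a b N` on
  `Fin (N+1)`, its real Gram matrix `legendreGram`, the coordinates `constCoords` of `η₀`
  (`gram_legendreWindowFamily`, `constVector_eq_sum_legendreWindowFamily`, `constVector_mem_span`),
  so that `gap_of_real_certificate` + `opIneq_of_compression_gap` turn a real PSD certificate for
  `certQuadForm (legendreGram L N) t (constCoords L N) a₀ μ` plus a norm bound `‖𝐊_I − T‖ ≤ δ`,
  `δ ≤ min(1, μ)`, into `hpos`; the reduced form of that quadratic form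
  (`certQuadForm_legendreGram_eq`: `L` times an expression affine in `L = b − a`) and the ENDPOINT
  TEST `certQuadForm_legendreGram_nonneg_of_endpoints` (nonnegativity at `L = lo` and `L = hi`,
  `lo ≤ L ≤ hi`, suffices — so a certificate may be checked in exact rational arithmetic although
  `L = log 2` is transcendental).

The measure-theoretic half — **(S1)** the Hilbert–Schmidt bound `‖windowOp κ − finRankOp p t‖² ≤
∬_{I×I} |κ(y − x) − Σ t_ij f_i(y) f̄_j(x)|² dx dy` (Cauchy–Schwarz on the Schwartz-kernel form
`WindowOperatorCompact.inner_windowOp_eq_integral_integral`) and **(S4)** the expansion of that double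
integral into the finitely many "analytic inputs" `M_ij = ⟪p_i, 𝐊_I p_j⟫`, `H = ∬|κ(y−x)|²` and `Γ` —
is the sequel file `SpectralCertSoundHS.lean`.  [RH-FREE; bears on the cell's bookkeeping (W-C/W-P)
only through the consumer `hpos`; WHAT THIS IS NOT: any statement about `ζ`.]
-/

noncomputable section

open MeasureTheory Set Complex Filter Function Polynomial
open scoped ComplexConjugate InnerProductSpace

namespace Literature.NumberTheory.ConnesConsani2021

namespace SpectralCert

/-! ## (S2) The compression-gap inequality (abstract Hilbert space) -/

section CompressionGap

variable {𝕜 : Type*} {E : Type*} [RCLike 𝕜] [NormedAddCommGroup E] [InnerProductSpace 𝕜 E]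
variable (V : Submodule 𝕜 E) [V.HasOrthogonalProjection]
variable {K T : E →L[𝕜] E} {φ₀ : E} {a₀ μ δ : ℝ}

/-- RH-FREE. **Compression identity.**  If `T` factors through the orthogonal projection `P_V`
(`T ξ = T (P_V ξ)`) with range in `V`, and `φ₀ ∈ V`, then with `v = P_V ξ`, `w = ξ − v`:
`re⟪ξ, ξ − Tξ⟫ + a₀|⟪φ₀, ξ⟫|² = ‖w‖² + (re⟪v, v − Tv⟫ + a₀|⟪φ₀, v⟫|²)` ("using `1 = |η⟩⟨η| + P_η`",
the decomposition step of Lemma 6.10's proof, here for a finite-rank compression).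
[cite: ConnesConsani2021, §6.7 p. 28 (display before Lemma 6.9; pattern)] -/
theorem re_inner_sub_add_eq_of_compression (hφ₀ : φ₀ ∈ V)
    (hTV : ∀ ξ, T ξ = T (V.starProjection ξ)) (hTr : ∀ ξ, T ξ ∈ V) (a₀ : ℝ) (ξ : E) :
    RCLike.re ⟪ξ, ξ - T ξ⟫_𝕜 + a₀ * ‖⟪φ₀, ξ⟫_𝕜‖ ^ 2
      = ‖ξ - V.starProjection ξ‖ ^ 2
        + (RCLike.re ⟪V.starProjection ξ, V.starProjection ξ - T (V.starProjection ξ)⟫_𝕜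
            + a₀ * ‖⟪φ₀, V.starProjection ξ⟫_𝕜‖ ^ 2) := by
  set v := V.starProjection ξ with hv
  have hw : ξ - v ∈ Vᗮ := V.sub_starProjection_mem_orthogonal ξ
  have hvV : v ∈ V := V.starProjection_apply_mem ξ
  -- `⟪ξ, Tξ⟫ = ⟪v, Tv⟫`
  have h1 : ⟪ξ, T ξ⟫_𝕜 = ⟪v, T v⟫_𝕜 := by
    rw [hTV ξ, ← hv]
    have : ξ = v + (ξ - v) := by abel
    conv_lhs => rw [this]
    rw [inner_add_left, Submodule.inner_left_of_mem_orthogonal (hTr v) hw, add_zero]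
  -- `⟪φ₀, ξ⟫ = ⟪φ₀, v⟫`
  have h2 : ⟪φ₀, ξ⟫_𝕜 = ⟪φ₀, v⟫_𝕜 := by
    have : ξ = v + (ξ - v) := by abel
    conv_lhs => rw [this]
    rw [inner_add_right, Submodule.inner_right_of_mem_orthogonal hφ₀ hw, add_zero]
  -- `‖ξ‖² = ‖v‖² + ‖w‖²`
  have h3 : ‖ξ‖ ^ 2 = ‖v‖ ^ 2 + ‖ξ - v‖ ^ 2 := by
    rw [V.norm_sq_eq_add_norm_sq_starProjection ξ, Submodule.starProjection_orthogonal_val]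
  rw [inner_sub_right, inner_sub_right, map_sub, map_sub, inner_self_eq_norm_sq (𝕜 := 𝕜),
    inner_self_eq_norm_sq (𝕜 := 𝕜), h1, h2, h3]
  ring

/-- RH-FREE. **The compression-gap estimate with margin.**  Under the factorisation hypotheses of
`re_inner_sub_add_eq_of_compression`, a gap `μ` of the compressed pencil on `V`
(`μ‖v‖² ≤ re⟪v, v − Tv⟫ + a₀|⟪φ₀, v⟫|²` for `v ∈ V`) and `‖K − T‖ ≤ δ` give
`(min(1, μ) − δ)‖ξ‖² ≤ re⟪ξ, ξ − Kξ⟫ + a₀|⟪φ₀, ξ⟫|²` for every `ξ`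
(CC Lemma 6.10: "`⟨ξ|(1 − 𝐊_I)ξ⟩ + a|⟨η₀|ξ⟩|² ≥ (ε₂ − ε₁)‖ξ‖²`", with the rank-one gap replaced by a
finite-rank compression gap). [cite: ConnesConsani2021, Lemma 6.10 §6.7 p. 28 (proof pattern)] -/
theorem re_inner_sub_add_ge_of_compression_gap (hφ₀ : φ₀ ∈ V)
    (hTV : ∀ ξ, T ξ = T (V.starProjection ξ)) (hTr : ∀ ξ, T ξ ∈ V)
    (hgap : ∀ v ∈ V, μ * ‖v‖ ^ 2 ≤ RCLike.re ⟪v, v - T v⟫_𝕜 + a₀ * ‖⟪φ₀, v⟫_𝕜‖ ^ 2)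
    (hKT : ‖K - T‖ ≤ δ) (ξ : E) :
    (min 1 μ - δ) * ‖ξ‖ ^ 2 ≤ RCLike.re ⟪ξ, ξ - K ξ⟫_𝕜 + a₀ * ‖⟪φ₀, ξ⟫_𝕜‖ ^ 2 := by
  set v := V.starProjection ξ with hv
  have hvV : v ∈ V := V.starProjection_apply_mem ξ
  have hdec := re_inner_sub_add_eq_of_compression V hφ₀ hTV hTr a₀ ξ
  have h3 : ‖ξ‖ ^ 2 = ‖v‖ ^ 2 + ‖ξ - v‖ ^ 2 := by
    rw [V.norm_sq_eq_add_norm_sq_starProjection ξ, Submodule.starProjection_orthogonal_val]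
  -- `re⟪ξ, ξ − Kξ⟫ = re⟪ξ, ξ − Tξ⟫ − re⟪ξ, (K − T)ξ⟫` and `|⟪ξ, (K − T)ξ⟫| ≤ δ‖ξ‖²`
  have hsplit : RCLike.re ⟪ξ, ξ - K ξ⟫_𝕜
      = RCLike.re ⟪ξ, ξ - T ξ⟫_𝕜 - RCLike.re ⟪ξ, (K - T) ξ⟫_𝕜 := by
    rw [show ξ - K ξ = (ξ - T ξ) - (K - T) ξ by
      rw [show (K - T) ξ = K ξ - T ξ from rfl]; abel, inner_sub_right, map_sub]
  have hpert : RCLike.re ⟪ξ, (K - T) ξ⟫_𝕜 ≤ δ * ‖ξ‖ ^ 2 := by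
    calc RCLike.re ⟪ξ, (K - T) ξ⟫_𝕜 ≤ ‖⟪ξ, (K - T) ξ⟫_𝕜‖ := RCLike.re_le_norm _
      _ ≤ ‖ξ‖ * ‖(K - T) ξ‖ := norm_inner_le_norm _ _
      _ ≤ ‖ξ‖ * (‖K - T‖ * ‖ξ‖) :=
          mul_le_mul_of_nonneg_left ((K - T).le_opNorm ξ) (norm_nonneg _)
      _ ≤ ‖ξ‖ * (δ * ‖ξ‖) :=
          mul_le_mul_of_nonneg_left (mul_le_mul_of_nonneg_right hKT (norm_nonneg _)) (norm_nonneg _)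
      _ = δ * ‖ξ‖ ^ 2 := by ring
  have hgapv := hgap v hvV
  have hm1 : min 1 μ ≤ 1 := min_le_left _ _
  have hm2 : min 1 μ ≤ μ := min_le_right _ _
  have hw0 : 0 ≤ ‖ξ - v‖ ^ 2 := sq_nonneg _
  have hv0 : 0 ≤ ‖v‖ ^ 2 := sq_nonneg _
  rw [hsplit]
  nlinarith [hdec, hgapv, hpert, h3, mul_le_mul_of_nonneg_right hm1 hw0,
    mul_le_mul_of_nonneg_right hm2 hv0]

/-- RH-FREE. **(S2) `opIneq_of_compression_gap`** — the sign-free operator inequality of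
Connes–Consani's Lemma 6.10 from a FINITE-RANK COMPRESSION certificate: `T` factors through `P_V` with
range in `V`, `φ₀ ∈ V`, gap `μ` on `V`, `‖K − T‖ ≤ δ`, `δ ≤ 1`, `δ ≤ μ` ⊢
`0 ≤ re⟪ξ, ξ − Kξ⟫ + a₀|⟪φ₀, ξ⟫|²` for every `ξ` — the shape of the hypothesis `hpos` of
`MainInequalityAssembly.weilArchPositivity_soninTrace_fine_of_opIneq` (there `K = windowOp ϖ`,
`φ₀ = constVector`). [cite: ConnesConsani2021, Lemma 6.10 §6.7 p. 28 (proof pattern)] -/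
theorem opIneq_of_compression_gap (hφ₀ : φ₀ ∈ V)
    (hTV : ∀ ξ, T ξ = T (V.starProjection ξ)) (hTr : ∀ ξ, T ξ ∈ V)
    (hgap : ∀ v ∈ V, μ * ‖v‖ ^ 2 ≤ RCLike.re ⟪v, v - T v⟫_𝕜 + a₀ * ‖⟪φ₀, v⟫_𝕜‖ ^ 2)
    (hKT : ‖K - T‖ ≤ δ) (hδ1 : δ ≤ 1) (hδμ : δ ≤ μ) (ξ : E) :
    0 ≤ RCLike.re ⟪ξ, ξ - K ξ⟫_𝕜 + a₀ * ‖⟪φ₀, ξ⟫_𝕜‖ ^ 2 :=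
  le_trans (mul_nonneg (sub_nonneg.2 (le_min hδ1 hδμ)) (sq_nonneg _))
    (re_inner_sub_add_ge_of_compression_gap V hφ₀ hTV hTr hgap hKT ξ)

end CompressionGap

/-! ## Finite-rank operators on a finite family of vectors, and their coordinates -/

section FiniteRank

variable {𝕜 : Type*} {E : Type*} [RCLike 𝕜] [NormedAddCommGroup E] [InnerProductSpace 𝕜 E]
variable {ι : Type*}

/-- RH-FREE. The Gram matrix `Γ_ij = ⟪p_i, p_j⟫` of a finite family (complex entries; for the Legendre
window family it is the real diagonal `diag((b−a)/(2i+1))`, `gram_legendreWindowFamily`).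
[cite: ConnesConsani2021, §6.5 Lemma 6.6 p. 25 (Gram data of a non-orthogonal family, pattern)] -/
def gram (p : ι → E) : Matrix ι ι 𝕜 := Matrix.of fun i j ↦ ⟪p i, p j⟫_𝕜

/-- RH-FREE. Unfolding `gram`. [cite: ConnesConsani2021, §6.5 p. 25 (pattern)] -/
@[simp] theorem gram_apply (p : ι → E) (i j : ι) : gram (𝕜 := 𝕜) p i j = ⟪p i, p j⟫_𝕜 := rfl

variable [Fintype ι]

/-- RH-FREE. The finite-rank operator `T = Σ_{i,j} t_ij |p_i⟩⟨p_j|` on a finite family `p` with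
coefficient matrix `t` (`|x⟩⟨y| ξ = ⟪y, ξ⟫ x` is Mathlib's `InnerProductSpace.rankOne`); the
Galerkin approximant of the certificate. [cite: ConnesConsani2021, §6.4 eq. (opT) p. 24 (finite-rank approximant, pattern)] -/
def finRankOp (p : ι → E) (t : Matrix ι ι 𝕜) : E →L[𝕜] E :=
  ∑ i, ∑ j, t i j • InnerProductSpace.rankOne 𝕜 (p i) (p j)

/-- RH-FREE. `T ξ = Σ_{i,j} t_ij ⟪p_j, ξ⟫ p_i`. [cite: ConnesConsani2021, §6.4 eq. (opT) p. 24 (pattern)] -/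
theorem finRankOp_apply (p : ι → E) (t : Matrix ι ι 𝕜) (ξ : E) :
    finRankOp p t ξ = ∑ i, ∑ j, t i j • (⟪p j, ξ⟫_𝕜 • p i) := by
  simp only [finRankOp, FunLike.coe_sum, Finset.sum_apply, FunLike.coe_smul,
    Pi.smul_apply, InnerProductSpace.rankOne_apply]

/-- RH-FREE. Matrix coefficients: `⟪η, T ξ⟫ = Σ_{i,j} t_ij ⟪η, p_i⟫ ⟪p_j, ξ⟫`.
[cite: ConnesConsani2021, §6.4 eq. (opT) p. 24 (pattern)] -/
theorem inner_finRankOp (p : ι → E) (t : Matrix ι ι 𝕜) (ξ η : E) :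
    ⟪η, finRankOp p t ξ⟫_𝕜 = ∑ i, ∑ j, t i j * (⟪η, p i⟫_𝕜 * ⟪p j, ξ⟫_𝕜) := by
  rw [finRankOp_apply, inner_sum]
  refine Finset.sum_congr rfl fun i _ ↦ ?_
  rw [inner_sum]
  refine Finset.sum_congr rfl fun j _ ↦ ?_
  rw [inner_smul_right, inner_smul_right]
  ring

/-- RH-FREE. The range of `T` lies in any subspace containing the family.
[cite: ConnesConsani2021, §6.4 p. 24 (pattern)] -/
theorem finRankOp_mem {V : Submodule 𝕜 E} (p : ι → E) (hp : ∀ i, p i ∈ V) (t : Matrix ι ι 𝕜)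
    (ξ : E) : finRankOp p t ξ ∈ V := by
  rw [finRankOp_apply]
  exact Submodule.sum_mem _ fun i _ ↦ Submodule.sum_mem _ fun j _ ↦
    Submodule.smul_mem _ _ (Submodule.smul_mem _ _ (hp i))

/-- RH-FREE. `T` vanishes on vectors orthogonal to the family ("`V_N^⊥`-vanishing").
[cite: ConnesConsani2021, §6.4 p. 24 (pattern)] -/
theorem finRankOp_eq_zero_of_orthogonal (p : ι → E) (t : Matrix ι ι 𝕜) {w : E}
    (hw : ∀ j, ⟪p j, w⟫_𝕜 = 0) : finRankOp p t w = 0 := by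
  rw [finRankOp_apply]
  simp [hw]

/-- RH-FREE. `T` factors through the orthogonal projection onto any subspace containing the family:
`T ξ = T (P_V ξ)`. [cite: ConnesConsani2021, §6.4 p. 24 (pattern)] -/
theorem finRankOp_apply_eq_starProjection {V : Submodule 𝕜 E} [V.HasOrthogonalProjection]
    (p : ι → E) (hp : ∀ i, p i ∈ V) (t : Matrix ι ι 𝕜) (ξ : E) :
    finRankOp p t ξ = finRankOp p t (V.starProjection ξ) := by
  have hw : ξ - V.starProjection ξ ∈ Vᗮ := V.sub_starProjection_mem_orthogonal ξ
  have h0 : finRankOp p t (ξ - V.starProjection ξ) = 0 :=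
    finRankOp_eq_zero_of_orthogonal p t fun j ↦ Submodule.inner_right_of_mem_orthogonal (hp j) hw
  have := congrArg (finRankOp p t) (sub_add_cancel ξ (V.starProjection ξ)).symm
  rw [this, map_add, h0, zero_add]

/-- RH-FREE. `⟪p_i, Σ_l c_l p_l⟫ = (Γ c)_i`. [cite: ConnesConsani2021, §6.5 p. 25 (pattern)] -/
theorem inner_left_sum_smul (p : ι → E) (c : ι → 𝕜) (i : ι) :
    ⟪p i, ∑ l, c l • p l⟫_𝕜 = (gram p).mulVec c i := by
  rw [inner_sum, Matrix.mulVec, dotProduct]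
  refine Finset.sum_congr rfl fun l _ ↦ ?_
  rw [inner_smul_right, gram_apply, mul_comm]

/-- RH-FREE. `⟪Σ_k c_k p_k, p_j⟫ = Σ_k conj(c_k) Γ_kj = (star c ᵥ* Γ)_j`.
[cite: ConnesConsani2021, §6.5 p. 25 (pattern)] -/
theorem inner_sum_smul_right (p : ι → E) (c : ι → 𝕜) (j : ι) :
    ⟪∑ k, c k • p k, p j⟫_𝕜 = Matrix.vecMul (star c) (gram p) j := by
  rw [sum_inner, Matrix.vecMul, dotProduct]
  refine Finset.sum_congr rfl fun k _ ↦ ?_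
  rw [inner_smul_left, gram_apply, Pi.star_apply, starRingEnd_apply]

/-- RH-FREE. `‖Σ c_i p_i‖²`, `⟪v, Tv⟫` and `⟪Σ e_i p_i, v⟫` in coordinates: for `v = Σ_i c_i p_i`,
`⟪v, v⟫ = star c ⬝ Γc`, `⟪v, T v⟫ = Σ_ij t_ij (star c ᵥ* Γ)_i (Γ c)_j`, `⟪Σ e_i p_i, v⟫ = star e ⬝ Γ c`.
[cite: ConnesConsani2021, §6.5 Lemma 6.6 p. 25 (coordinates in a non-orthogonal basis, pattern)] -/
theorem inner_coords (p : ι → E) (t : Matrix ι ι 𝕜) (c e : ι → 𝕜) :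
    ⟪∑ i, c i • p i, ∑ i, c i • p i⟫_𝕜 = star c ⬝ᵥ (gram p).mulVec c ∧
    ⟪∑ i, c i • p i, finRankOp p t (∑ i, c i • p i)⟫_𝕜
        = ∑ i, ∑ j, t i j * (Matrix.vecMul (star c) (gram p) i * (gram p).mulVec c j) ∧
    ⟪∑ i, e i • p i, ∑ i, c i • p i⟫_𝕜 = star e ⬝ᵥ (gram p).mulVec c := by
  refine ⟨?_, ?_, ?_⟩
  · rw [dotProduct, sum_inner]
    refine Finset.sum_congr rfl fun i _ ↦ ?_
    rw [inner_smul_left, inner_left_sum_smul, Pi.star_apply, starRingEnd_apply]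
  · rw [inner_finRankOp]
    refine Finset.sum_congr rfl fun i _ ↦ Finset.sum_congr rfl fun j _ ↦ ?_
    rw [inner_sum_smul_right, inner_left_sum_smul]
  · rw [dotProduct, sum_inner]
    refine Finset.sum_congr rfl fun i _ ↦ ?_
    rw [inner_smul_left, inner_left_sum_smul, Pi.star_apply, starRingEnd_apply]

/-- RH-FREE. **The gap hypothesis of (S2) in coordinates.**  If for every coefficient vector `c`
`μ · re(star c ⬝ Γc) ≤ re(star c ⬝ Γc − Σ_ij t_ij (star c ᵥ* Γ)_i (Γc)_j) + a₀ |star e ⬝ Γc|²`, then the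
compressed pencil of `T = Σ t_ij |p_i⟩⟨p_j|` and `φ₀ = Σ e_i p_i` has gap `μ` on `V = span p`.
[cite: ConnesConsani2021, §6.5–6.7 pp. 25–28 (spectral data of a finite-rank approximant, pattern)] -/
theorem gap_of_coords (p : ι → E) (t : Matrix ι ι 𝕜) (e : ι → 𝕜) {a₀ μ : ℝ}
    (h : ∀ c : ι → 𝕜,
      μ * RCLike.re (star c ⬝ᵥ (gram p).mulVec c)
        ≤ RCLike.re (star c ⬝ᵥ (gram p).mulVec c
            - ∑ i, ∑ j, t i j * (Matrix.vecMul (star c) (gram p) i * (gram p).mulVec c j))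
          + a₀ * ‖star e ⬝ᵥ (gram p).mulVec c‖ ^ 2) :
    ∀ v ∈ Submodule.span 𝕜 (Set.range p),
      μ * ‖v‖ ^ 2 ≤ RCLike.re ⟪v, v - finRankOp p t v⟫_𝕜 + a₀ * ‖⟪∑ i, e i • p i, v⟫_𝕜‖ ^ 2 := by
  intro v hv
  obtain ⟨c, rfl⟩ := (Submodule.mem_span_range_iff_exists_fun 𝕜).1 hv
  obtain ⟨h1, h2, h3⟩ := inner_coords p t c e
  have hn : ‖∑ i, c i • p i‖ ^ 2 = RCLike.re (star c ⬝ᵥ (gram p).mulVec c) := by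
    rw [← h1, inner_self_eq_norm_sq (𝕜 := 𝕜)]
  rw [hn, inner_sub_right, map_sub, h1, h2, h3, ← map_sub]
  exact h c

end FiniteRank


/-! ## Real data: the coordinate gap from a real quadratic form -/

section RealData

variable {ι : Type*} [Fintype ι]

/-- RH-FREE. The real quadratic form of the certificate: for real `Γ`, `t`, `e`,
`q(x) = xᵀΓx − Σ_ij t_ij (xᵀΓ)_i (Γx)_j + a₀ (eᵀΓx)² − μ xᵀΓx` (its nonnegativity for all real `x` is
what a PSD certificate over `ℚ` establishes).
[cite: ConnesConsani2021, §6.7 Lemma 6.9–6.10 p. 28 (finite-dimensional positivity test, pattern)] -/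
def certQuadForm (Γ t : Matrix ι ι ℝ) (e : ι → ℝ) (a₀ μ : ℝ) (x : ι → ℝ) : ℝ :=
  x ⬝ᵥ Γ.mulVec x - ∑ i, ∑ j, t i j * (Matrix.vecMul x Γ i * Γ.mulVec x j)
    + a₀ * (e ⬝ᵥ Γ.mulVec x) ^ 2 - μ * (x ⬝ᵥ Γ.mulVec x)

/-- `(A c)_j = (A x)_j + i (A y)_j` for a real matrix `A` and `c = x + iy`. [folklore] -/
private theorem mulVec_map_ofReal (A : Matrix ι ι ℝ) (c : ι → ℂ) (j : ι) :
    (A.map ((↑) : ℝ → ℂ)).mulVec c j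
      = ((A.mulVec (fun k ↦ (c k).re) j : ℝ) : ℂ)
        + ((A.mulVec (fun k ↦ (c k).im) j : ℝ) : ℂ) * I := by
  simp only [Matrix.mulVec, dotProduct, Matrix.map_apply, Complex.ofReal_sum, Finset.sum_mul,
    ← Finset.sum_add_distrib]
  refine Finset.sum_congr rfl fun k _ ↦ ?_
  have h := Complex.re_add_im (c k)
  push_cast
  linear_combination (-(A j k : ℂ)) * h

/-- `(c* A)_i = (x A)_i − i (y A)_i` for a real matrix `A` and `c = x + iy`. [folklore] -/
private theorem vecMul_star_map_ofReal (A : Matrix ι ι ℝ) (c : ι → ℂ) (i : ι) :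
    Matrix.vecMul (star c) (A.map ((↑) : ℝ → ℂ)) i
      = ((Matrix.vecMul (fun k ↦ (c k).re) A i : ℝ) : ℂ)
        - ((Matrix.vecMul (fun k ↦ (c k).im) A i : ℝ) : ℂ) * I := by
  simp only [Matrix.vecMul, dotProduct, Matrix.map_apply, Pi.star_apply, Complex.ofReal_sum,
    Finset.sum_mul, ← Finset.sum_sub_distrib]
  refine Finset.sum_congr rfl fun k _ ↦ ?_
  have h : (starRingEnd ℂ) (c k) = ((c k).re : ℂ) - ((c k).im : ℂ) * I := by
    rw [← Complex.re_add_im (c k), map_add, map_mul, Complex.conj_ofReal, Complex.conj_ofReal,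
      Complex.conj_I]
    simp only [Complex.re_add_im]
    ring
  rw [Complex.star_def, h]
  push_cast
  ring

/-- `re (star c ⬝ v) = Σ_j (re c_j · re v_j + im c_j · im v_j)`. [folklore] -/
private theorem re_star_dotProduct (c v : ι → ℂ) :
    (star c ⬝ᵥ v).re = ∑ j, ((c j).re * (v j).re + (c j).im * (v j).im) := by
  simp only [dotProduct, Complex.re_sum, Pi.star_apply, Complex.star_def, Complex.mul_re,
    Complex.conj_re, Complex.conj_im]
  refine Finset.sum_congr rfl fun j _ ↦ ?_
  ring

/-- RH-FREE. **Real data: the complex coordinate gap from the real quadratic form.**  If the real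
quadratic form `certQuadForm Γ t e a₀ μ` is nonnegative on `ℝ^ι`, then the coordinate inequality of
`gap_of_coords` holds for all COMPLEX coefficient vectors, with `Γ`, `t`, `e` cast to `ℂ` (write
`c = x + iy`; every term splits as `q(x) + q(y)`).
[cite: ConnesConsani2021, §6.7 Lemma 6.9–6.10 p. 28 (finite-dimensional positivity test, pattern)] -/
theorem coordsGap_of_real (Γ t : Matrix ι ι ℝ) (e : ι → ℝ) {a₀ μ : ℝ}
    (hq : ∀ x : ι → ℝ, 0 ≤ certQuadForm Γ t e a₀ μ x) (c : ι → ℂ) :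
    μ * (star c ⬝ᵥ (Γ.map ((↑) : ℝ → ℂ)).mulVec c).re
      ≤ (star c ⬝ᵥ (Γ.map ((↑) : ℝ → ℂ)).mulVec c
          - ∑ i, ∑ j, (t.map ((↑) : ℝ → ℂ)) i j *
              (Matrix.vecMul (star c) (Γ.map ((↑) : ℝ → ℂ)) i * (Γ.map ((↑) : ℝ → ℂ)).mulVec c j)).re
        + a₀ * ‖star (fun i ↦ ((e i : ℝ) : ℂ)) ⬝ᵥ (Γ.map ((↑) : ℝ → ℂ)).mulVec c‖ ^ 2 := by
  set x : ι → ℝ := fun k ↦ (c k).re with hx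
  set y : ι → ℝ := fun k ↦ (c k).im with hy
  -- (1) `re (c* Γ c) = xΓx + yΓy`
  have h1 : (star c ⬝ᵥ (Γ.map ((↑) : ℝ → ℂ)).mulVec c).re = x ⬝ᵥ Γ.mulVec x + y ⬝ᵥ Γ.mulVec y := by
    rw [re_star_dotProduct]
    simp only [mulVec_map_ofReal, Complex.add_re, Complex.ofReal_re, Complex.mul_re, Complex.I_re,
      Complex.I_im, Complex.ofReal_im, mul_zero, mul_one, sub_zero, Complex.add_im, Complex.mul_im,
      zero_add, add_zero, dotProduct, ← Finset.sum_add_distrib]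
    rfl
  -- (2) `re Σ t_ij (c*Γ)_i (Γc)_j = Σ t_ij ((xΓ)_i(Γx)_j + (yΓ)_i(Γy)_j)`
  have h2 : (∑ i, ∑ j, (t.map ((↑) : ℝ → ℂ)) i j *
      (Matrix.vecMul (star c) (Γ.map ((↑) : ℝ → ℂ)) i * (Γ.map ((↑) : ℝ → ℂ)).mulVec c j)).re
      = ∑ i, ∑ j, t i j * (Matrix.vecMul x Γ i * Γ.mulVec x j + Matrix.vecMul y Γ i * Γ.mulVec y j) := by
    rw [Complex.re_sum]
    refine Finset.sum_congr rfl fun i _ ↦ ?_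
    rw [Complex.re_sum]
    refine Finset.sum_congr rfl fun j _ ↦ ?_
    rw [Matrix.map_apply, vecMul_star_map_ofReal, mulVec_map_ofReal]
    simp only [Complex.mul_re, Complex.mul_im, Complex.sub_re, Complex.sub_im, Complex.add_re,
      Complex.add_im, Complex.ofReal_re, Complex.ofReal_im, Complex.I_re, Complex.I_im]
    ring
  -- (3) `c ↦ e* Γ c = (eΓx) + i (eΓy)`
  have h3 : star (fun i ↦ ((e i : ℝ) : ℂ)) ⬝ᵥ (Γ.map ((↑) : ℝ → ℂ)).mulVec c
      = ((e ⬝ᵥ Γ.mulVec x : ℝ) : ℂ) + ((e ⬝ᵥ Γ.mulVec y : ℝ) : ℂ) * I := by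
    simp only [dotProduct, Pi.star_apply, Complex.star_def, Complex.conj_ofReal, mulVec_map_ofReal,
      Complex.ofReal_sum, Complex.ofReal_mul, Finset.sum_mul, ← Finset.sum_add_distrib]
    refine Finset.sum_congr rfl fun j _ ↦ ?_
    ring
  have h4 : ‖star (fun i ↦ ((e i : ℝ) : ℂ)) ⬝ᵥ (Γ.map ((↑) : ℝ → ℂ)).mulVec c‖ ^ 2
      = (e ⬝ᵥ Γ.mulVec x) ^ 2 + (e ⬝ᵥ Γ.mulVec y) ^ 2 := by
    rw [h3, Complex.sq_norm, Complex.normSq_add_mul_I]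
  rw [Complex.sub_re, h1, h2, h4]
  have hqx := hq x
  have hqy := hq y
  simp only [certQuadForm] at hqx hqy
  have hsplit : ∑ i, ∑ j, t i j * (Matrix.vecMul x Γ i * Γ.mulVec x j + Matrix.vecMul y Γ i * Γ.mulVec y j)
      = ∑ i, ∑ j, t i j * (Matrix.vecMul x Γ i * Γ.mulVec x j)
        + ∑ i, ∑ j, t i j * (Matrix.vecMul y Γ i * Γ.mulVec y j) := by
    rw [← Finset.sum_add_distrib]
    refine Finset.sum_congr rfl fun i _ ↦ ?_
    rw [← Finset.sum_add_distrib]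
    refine Finset.sum_congr rfl fun j _ ↦ ?_
    ring
  rw [hsplit]
  nlinarith [hqx, hqy]

/-- RH-FREE. **The gap on `V = span p` from a real certificate**, for a family `p` whose Gram matrix is
the real matrix `Γ` and `φ₀ = Σ_i e_i p_i` with real `e`: nonnegativity of `certQuadForm Γ t e a₀ μ` on
`ℝ^ι` gives the hypothesis `hgap` of `opIneq_of_compression_gap` for `T = finRankOp p (t cast to ℂ)`.
[cite: ConnesConsani2021, §6.7 Lemma 6.9–6.10 p. 28 (pattern)] -/
theorem gap_of_real_certificate {E : Type*} [NormedAddCommGroup E] [InnerProductSpace ℂ E]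
    (p : ι → E) (Γ t : Matrix ι ι ℝ) (e : ι → ℝ) {a₀ μ : ℝ}
    (hΓ : gram (𝕜 := ℂ) p = Γ.map ((↑) : ℝ → ℂ))
    (hq : ∀ x : ι → ℝ, 0 ≤ certQuadForm Γ t e a₀ μ x) :
    ∀ v ∈ Submodule.span ℂ (Set.range p),
      μ * ‖v‖ ^ 2 ≤ RCLike.re ⟪v, v - finRankOp p (t.map ((↑) : ℝ → ℂ)) v⟫_ℂ
        + a₀ * ‖⟪∑ i, ((e i : ℝ) : ℂ) • p i, v⟫_ℂ‖ ^ 2 := by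
  refine gap_of_coords p (t.map ((↑) : ℝ → ℂ)) (fun i ↦ ((e i : ℝ) : ℂ)) fun c ↦ ?_
  rw [hΓ]
  exact coordsGap_of_real Γ t e hq c

end RealData


/-! ## (S3) The Legendre window family in `𝓗 = L²([a, b])` -/

section LegendreWindow

open Literature.Analysis.SpecialFunctions

variable {a b : ℝ}

/-- RH-FREE. The rescaled Legendre polynomial on the window `[a, b]`:
`p_i(x) = P_i((2x − a − b)/(b − a))` (complex values; for CC's `I = [−½ log 2, ½ log 2]` this is
`P_i(2x/log 2)`), with the tree's Rodrigues `legendre`.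
[cite: ConnesConsani2021, §6.4 p. 24 (finite-rank approximant on L²(I); basis choice of the certificate)] -/
def legendreWindowFn (a b : ℝ) (i : ℕ) (x : ℝ) : ℂ :=
  (((legendre i).eval ((2 * x - (a + b)) / (b - a)) : ℝ) : ℂ)

/-- RH-FREE. Unfolding `legendreWindowFn`. [cite: ConnesConsani2021, §6.4 p. 24 (pattern)] -/
theorem legendreWindowFn_apply (a b : ℝ) (i : ℕ) (x : ℝ) :
    legendreWindowFn a b i x = (((legendre i).eval ((2 * x - (a + b)) / (b - a)) : ℝ) : ℂ) := rfl

/-- RH-FREE. `p_0 = 1`. [cite: ConnesConsani2021, §6.7 p. 28 (η₀ = the constant function)] -/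
theorem legendreWindowFn_zero (a b x : ℝ) : legendreWindowFn a b 0 x = 1 := by
  rw [legendreWindowFn_apply, legendre_zero, eval_one, Complex.ofReal_one]

/-- RH-FREE. `p_i` is continuous. [cite: ConnesConsani2021, §6.4 p. 24 (pattern)] -/
theorem continuous_legendreWindowFn (a b : ℝ) (i : ℕ) : Continuous (legendreWindowFn a b i) :=
  Complex.continuous_ofReal.comp
    ((legendre i).continuous.comp ((continuous_const.mul continuous_id).sub continuous_const
      |>.div_const _))

/-- RH-FREE. `p_i` is real-valued: `conj p_i = p_i`. [cite: ConnesConsani2021, §6.4 p. 24 (pattern)] -/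
theorem conj_legendreWindowFn (a b : ℝ) (i : ℕ) (x : ℝ) :
    conj (legendreWindowFn a b i x) = legendreWindowFn a b i x := by
  rw [legendreWindowFn_apply, Complex.conj_ofReal]

/-- A continuous function is in `L²([a, b])`. [folklore] -/
private theorem memLp_restrict_Icc_of_continuous {f : ℝ → ℂ} (hf : Continuous f) (a b : ℝ) :
    MemLp f 2 (volume.restrict (Icc a b)) := by
  obtain ⟨C, hC⟩ := isCompact_Icc.exists_bound_of_continuousOn (hf.continuousOn (s := Icc a b))
  have h : MemLp f ⊤ (volume.restrict (Icc a b)) :=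
    memLp_top_of_bound hf.aestronglyMeasurable C
      ((ae_restrict_iff' measurableSet_Icc).2 (Eventually.of_forall hC))
  exact h.mono_exponent le_top

/-- RH-FREE. `p_i ∈ L²([a, b])`. [cite: ConnesConsani2021, §6.4 p. 24 (pattern)] -/
theorem memLp_legendreWindowFn (a b : ℝ) (i : ℕ) :
    MemLp (legendreWindowFn a b i) 2 (volume.restrict (Icc a b)) :=
  memLp_restrict_Icc_of_continuous (continuous_legendreWindowFn a b i) a b

/-- RH-FREE. The Legendre window vector `p_i ∈ 𝓗 = L²([a, b], dx)`.
[cite: ConnesConsani2021, §6.4 p. 24 (finite-rank approximant on L²(I); basis choice of the certificate)] -/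
def legendreWindowVec (a b : ℝ) (i : ℕ) : Lp ℂ 2 (volume.restrict (Icc a b)) :=
  (memLp_legendreWindowFn a b i).toLp _

/-- RH-FREE. `p_i` represents `legendreWindowVec a b i` a.e. [cite: ConnesConsani2021, §6.4 p. 24 (pattern)] -/
theorem coeFn_legendreWindowVec (a b : ℝ) (i : ℕ) :
    (legendreWindowVec a b i : ℝ → ℂ) =ᵐ[volume.restrict (Icc a b)] legendreWindowFn a b i :=
  MemLp.coeFn_toLp _

/-- The substitution `u = (2x − a − b)/(b − a)`: `∫_a^b g(u(x)) dx = ((b − a)/2) ∫_{−1}^1 g`. [folklore] -/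
private theorem integral_comp_window (hab : a < b) (g : ℝ → ℝ) :
    ∫ x in a..b, g ((2 * x - (a + b)) / (b - a)) = (b - a) / 2 * ∫ u in (-1 : ℝ)..1, g u := by
  have hL : b - a ≠ 0 := sub_ne_zero.2 hab.ne'
  have hc : (2 / (b - a) : ℝ) ≠ 0 := div_ne_zero two_ne_zero hL
  have e : ∀ x : ℝ, (2 * x - (a + b)) / (b - a) = 2 / (b - a) * x + -(a + b) / (b - a) := by
    intro x; field_simp; ring
  simp_rw [e]
  rw [intervalIntegral.integral_comp_mul_add _ hc, smul_eq_mul]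
  have h1 : 2 / (b - a) * a + -(a + b) / (b - a) = -1 := by field_simp; ring
  have h2 : 2 / (b - a) * b + -(a + b) / (b - a) = 1 := by field_simp; ring
  rw [h1, h2]
  congr 1
  field_simp

/-- RH-FREE. **Gram matrix of the Legendre window family**: `⟪p_i, p_j⟫ = δ_ij (b − a)/(2i + 1)`
(substitution `u = (2x − a − b)/(b − a)` and the tree's Legendre orthogonality
`integral_legendre_mul_legendre_eq_zero`, `integral_legendre_sq`: `∫_{−1}^1 P_i P_j = δ_ij 2/(2i+1)`).
[cite: ConnesConsani2021, §6.5 Lemma 6.6 p. 25 (Gram data of the basis, pattern); AndrewsAskeyRoy1999 (2.5.14)] -/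
theorem inner_legendreWindowVec (hab : a < b) (i j : ℕ) :
    ⟪legendreWindowVec a b i, legendreWindowVec a b j⟫_ℂ
      = if i = j then (((b - a) / (2 * i + 1) : ℝ) : ℂ) else 0 := by
  rw [L2.inner_def]
  have h1 : ∫ x, ⟪(legendreWindowVec a b i : ℝ → ℂ) x, (legendreWindowVec a b j : ℝ → ℂ) x⟫_ℂ
        ∂(volume.restrict (Icc a b))
      = ∫ x in Icc a b, (((legendre i).eval ((2 * x - (a + b)) / (b - a))
          * (legendre j).eval ((2 * x - (a + b)) / (b - a)) : ℝ) : ℂ) := by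
    refine integral_congr_ae ?_
    filter_upwards [coeFn_legendreWindowVec a b i, coeFn_legendreWindowVec a b j] with x hi hj
    rw [hi, hj, RCLike.inner_apply', conj_legendreWindowFn, legendreWindowFn_apply,
      legendreWindowFn_apply, ← Complex.ofReal_mul]
  rw [h1, integral_complex_ofReal, integral_Icc_eq_integral_Ioc,
    ← intervalIntegral.integral_of_le hab.le,
    integral_comp_window hab (fun u ↦ (legendre i).eval u * (legendre j).eval u)]
  rcases lt_trichotomy i j with hij | rfl | hji
  · rw [if_neg hij.ne]
    have h0 : ∫ u in (-1 : ℝ)..1, (legendre i).eval u * (legendre j).eval u = 0 := by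
      simp_rw [mul_comm ((legendre i).eval _)]
      exact integral_legendre_mul_legendre_eq_zero hij
    rw [h0, mul_zero, Complex.ofReal_zero]
  · rw [if_pos rfl]
    have h0 : ∫ u in (-1 : ℝ)..1, (legendre i).eval u * (legendre i).eval u = 2 / (2 * i + 1) := by
      simp_rw [← sq]; exact integral_legendre_sq i
    rw [h0]
    congr 1
    field_simp
  · rw [if_neg hji.ne', integral_legendre_mul_legendre_eq_zero hji, mul_zero, Complex.ofReal_zero]

/-- RH-FREE. `‖p_i‖² = (b − a)/(2i + 1)`. [cite: ConnesConsani2021, §6.5 p. 25 (pattern); AndrewsAskeyRoy1999 (2.5.14)] -/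
theorem norm_legendreWindowVec_sq (hab : a < b) (i : ℕ) :
    ‖legendreWindowVec a b i‖ ^ 2 = (b - a) / (2 * i + 1) := by
  have h := inner_legendreWindowVec hab i i
  rw [if_pos rfl, inner_self_eq_norm_sq_to_K] at h
  have h' : ((‖legendreWindowVec a b i‖ ^ 2 : ℝ) : ℂ) = (((b - a) / (2 * i + 1) : ℝ) : ℂ) := by
    rw [← h]; push_cast; rfl
  exact_mod_cast h'

/-- RH-FREE. **`η₀ = p₀/√(b − a)`**: CC's unit constant vector `constVector a b` (§6.7: "the constant
function normalized to be of norm 1") is `(b − a)^{−1/2} • p₀`. [cite: ConnesConsani2021, §6.7 p. 28] -/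
theorem constVector_eq_smul_legendreWindowVec (a b : ℝ) :
    constVector a b = (((Real.sqrt (b - a))⁻¹ : ℝ) : ℂ) • legendreWindowVec a b 0 := by
  refine Lp.ext ?_
  filter_upwards [coeFn_constVector a b, Lp.coeFn_smul (((Real.sqrt (b - a))⁻¹ : ℝ) : ℂ)
    (legendreWindowVec a b 0), coeFn_legendreWindowVec a b 0] with x h1 h2 h3
  rw [h1, h2, Pi.smul_apply, h3, legendreWindowFn_zero, smul_eq_mul, mul_one]

variable (a b)

/-- RH-FREE. The finite Legendre window family `(p_i)_{i ≤ N}` indexed by `Fin (N+1)`.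
[cite: ConnesConsani2021, §6.4 p. 24 (finite-rank approximant, basis choice of the certificate)] -/
def legendreWindowFamily (N : ℕ) (i : Fin (N + 1)) : Lp ℂ 2 (volume.restrict (Icc a b)) :=
  legendreWindowVec a b i

/-- RH-FREE. The (real, diagonal) Gram matrix of the Legendre window family: `diag((b − a)/(2i+1))`.
[cite: ConnesConsani2021, §6.5 p. 25 (pattern); AndrewsAskeyRoy1999 (2.5.14)] -/
def legendreGram (L : ℝ) (N : ℕ) : Matrix (Fin (N + 1)) (Fin (N + 1)) ℝ :=
  Matrix.diagonal fun i ↦ L / (2 * (i : ℕ) + 1)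

/-- RH-FREE. The coordinates of `η₀` in the Legendre window family: `e = (b − a)^{−1/2} δ_0`.
[cite: ConnesConsani2021, §6.7 p. 28 (η₀)] -/
def constCoords (L : ℝ) (N : ℕ) (i : Fin (N + 1)) : ℝ := if (i : ℕ) = 0 then (Real.sqrt L)⁻¹ else 0

variable {a b}

/-- RH-FREE. `gram (legendreWindowFamily a b N) = legendreGram (b − a) N` (cast to `ℂ`).
[cite: ConnesConsani2021, §6.5 p. 25 (pattern); AndrewsAskeyRoy1999 (2.5.14)] -/
theorem gram_legendreWindowFamily (hab : a < b) (N : ℕ) :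
    gram (𝕜 := ℂ) (legendreWindowFamily a b N) = (legendreGram (b - a) N).map ((↑) : ℝ → ℂ) := by
  ext i j
  rw [gram_apply, legendreWindowFamily, legendreWindowFamily, inner_legendreWindowVec hab,
    Matrix.map_apply, legendreGram, Matrix.diagonal_apply]
  by_cases h : i = j
  · subst h; simp
  · rw [if_neg (fun h' ↦ h (Fin.ext h')), if_neg h, Complex.ofReal_zero]

/-- RH-FREE. `η₀ = Σ_i e_i p_i` with `e = constCoords (b − a) N`.
[cite: ConnesConsani2021, §6.7 p. 28 (η₀)] -/
theorem constVector_eq_sum_legendreWindowFamily (a b : ℝ) (N : ℕ) :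
    constVector a b = ∑ i : Fin (N + 1), ((constCoords (b - a) N i : ℝ) : ℂ) • legendreWindowFamily a b N i := by
  rw [Finset.sum_eq_single (0 : Fin (N + 1))]
  · have h0 : constCoords (b - a) N 0 = (Real.sqrt (b - a))⁻¹ := by simp [constCoords]
    rw [h0, legendreWindowFamily, Fin.val_zero, constVector_eq_smul_legendreWindowVec]
  · intro i _ hi
    have h0 : constCoords (b - a) N i = 0 := by
      simp only [constCoords, ite_eq_right_iff]
      intro h; exact absurd (Fin.ext (by simpa using h)) hi
    rw [h0, Complex.ofReal_zero, zero_smul]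
  · intro h; exact absurd (Finset.mem_univ _) h

/-- RH-FREE. Each `p_i` lies in the span `V_N` of the family (so `finRankOp` on the family maps into
`V_N` and kills `V_N^⊥`: `finRankOp_mem`, `finRankOp_eq_zero_of_orthogonal`).
[cite: ConnesConsani2021, §6.4 p. 24 (pattern)] -/
theorem legendreWindowFamily_mem_span (N : ℕ) (i : Fin (N + 1)) :
    legendreWindowFamily a b N i ∈ Submodule.span ℂ (Set.range (legendreWindowFamily a b N)) :=
  Submodule.subset_span ⟨i, rfl⟩

/-- RH-FREE. `η₀ ∈ V_N`. [cite: ConnesConsani2021, §6.7 p. 28 (η₀)] -/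
theorem constVector_mem_span (N : ℕ) :
    constVector a b ∈ Submodule.span ℂ (Set.range (legendreWindowFamily a b N)) := by
  rw [constVector_eq_sum_legendreWindowFamily a b N]
  exact Submodule.sum_mem _ fun i _ ↦ Submodule.smul_mem _ _ (legendreWindowFamily_mem_span N i)

end LegendreWindow

/-! ## The certificate's quadratic form for the Legendre data: reduced form and the endpoint test -/

section LegendreData

/-- RH-FREE. **Reduced form of the certificate's quadratic form for the Legendre data.**  With
`Γ = legendreGram L N = diag(L/(2i+1))` and `e = constCoords L N = L^{-1/2} δ_0` (`L = b − a ≥ 0`),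
`certQuadForm Γ t e a₀ μ x = L · ((1 − μ) Σ_i x_i²/(2i+1) + a₀ x_0² − L Σ_ij t_ij (x_i/(2i+1)) (x_j/(2j+1)))`:
the form is `L` times an expression AFFINE in `L` (the only transcendental datum, `L = log 2` for CC's
window). [cite: ConnesConsani2021, §6.7 Lemma 6.9–6.10 p. 28 (finite-dimensional positivity test, pattern)] -/
theorem certQuadForm_legendreGram_eq {L : ℝ} (hL : 0 ≤ L) (N : ℕ)
    (t : Matrix (Fin (N + 1)) (Fin (N + 1)) ℝ) (a₀ μ : ℝ) (x : Fin (N + 1) → ℝ) :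
    certQuadForm (legendreGram L N) t (constCoords L N) a₀ μ x
      = L * ((1 - μ) * ∑ i, x i ^ 2 / (2 * (i : ℕ) + 1) + a₀ * x 0 ^ 2
          - L * ∑ i, ∑ j, t i j * ((x i / (2 * (i : ℕ) + 1)) * (x j / (2 * (j : ℕ) + 1)))) := by
  have hΓx : ∀ j, (legendreGram L N).mulVec x j = L / (2 * (j : ℕ) + 1) * x j := fun j ↦ by
    rw [legendreGram, Matrix.mulVec_diagonal]
  have hxΓ : ∀ i, Matrix.vecMul x (legendreGram L N) i = x i * (L / (2 * (i : ℕ) + 1)) := fun i ↦ by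
    rw [legendreGram, Matrix.vecMul_diagonal]
  have hxx : x ⬝ᵥ (legendreGram L N).mulVec x = L * ∑ i, x i ^ 2 / (2 * (i : ℕ) + 1) := by
    rw [dotProduct, Finset.mul_sum]
    refine Finset.sum_congr rfl fun i _ ↦ ?_
    rw [hΓx]
    ring
  have he : constCoords L N ⬝ᵥ (legendreGram L N).mulVec x = Real.sqrt L * x 0 := by
    rw [dotProduct, Finset.sum_eq_single (0 : Fin (N + 1))]
    · have h0 : constCoords L N 0 = (Real.sqrt L)⁻¹ := by simp [constCoords]
      rw [h0, hΓx, Fin.val_zero, Nat.cast_zero, mul_zero, zero_add, div_one]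
      by_cases hL0 : L = 0
      · simp [hL0]
      · have hs : Real.sqrt L ≠ 0 := fun h ↦ hL0 ((Real.sqrt_eq_zero hL).1 h)
        have key : (Real.sqrt L)⁻¹ * L = Real.sqrt L := by
          rw [eq_comm, eq_inv_mul_iff_mul_eq₀ hs, Real.mul_self_sqrt hL]
        rw [← mul_assoc, key]
    · intro i _ hi
      have h0 : constCoords L N i = 0 := by
        simp only [constCoords, ite_eq_right_iff]
        intro h
        exact absurd (Fin.ext (by simpa using h)) hi
      rw [h0, zero_mul]
    · intro h
      exact absurd (Finset.mem_univ _) h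
  have hT : ∑ i, ∑ j, t i j * (Matrix.vecMul x (legendreGram L N) i * (legendreGram L N).mulVec x j)
      = L * (L * ∑ i, ∑ j, t i j * ((x i / (2 * (i : ℕ) + 1)) * (x j / (2 * (j : ℕ) + 1)))) := by
    rw [Finset.mul_sum, Finset.mul_sum]
    refine Finset.sum_congr rfl fun i _ ↦ ?_
    rw [Finset.mul_sum, Finset.mul_sum]
    refine Finset.sum_congr rfl fun j _ ↦ ?_
    rw [hxΓ, hΓx]
    ring
  rw [certQuadForm, hxx, he, hT, mul_pow, Real.sq_sqrt hL]
  ring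

/-- RH-FREE. **Endpoint test.**  Because the reduced form is affine in `L`, nonnegativity of the two
quadratic forms obtained by freezing `L` at the ends of an enclosure `lo ≤ L ≤ hi` (rational, say)
implies `certQuadForm (legendreGram L N) t (constCoords L N) a₀ μ x ≥ 0` for all real `x` at the true
(transcendental) `L ≥ 0`: the PSD certificate may be checked at `L = lo` and `L = hi` in exact
rational arithmetic. [cite: ConnesConsani2021, §6.7 Lemma 6.9–6.10 p. 28 (finite-dimensional positivity test, pattern)] -/
theorem certQuadForm_legendreGram_nonneg_of_endpoints {L lo hi : ℝ} (hL : 0 ≤ L) (hlo : lo ≤ L)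
    (hhi : L ≤ hi) (N : ℕ) (t : Matrix (Fin (N + 1)) (Fin (N + 1)) ℝ) {a₀ μ : ℝ}
    (h_lo : ∀ x : Fin (N + 1) → ℝ, 0 ≤ (1 - μ) * ∑ i, x i ^ 2 / (2 * (i : ℕ) + 1) + a₀ * x 0 ^ 2
      - lo * ∑ i, ∑ j, t i j * ((x i / (2 * (i : ℕ) + 1)) * (x j / (2 * (j : ℕ) + 1))))
    (h_hi : ∀ x : Fin (N + 1) → ℝ, 0 ≤ (1 - μ) * ∑ i, x i ^ 2 / (2 * (i : ℕ) + 1) + a₀ * x 0 ^ 2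
      - hi * ∑ i, ∑ j, t i j * ((x i / (2 * (i : ℕ) + 1)) * (x j / (2 * (j : ℕ) + 1))))
    (x : Fin (N + 1) → ℝ) :
    0 ≤ certQuadForm (legendreGram L N) t (constCoords L N) a₀ μ x := by
  rw [certQuadForm_legendreGram_eq hL]
  refine mul_nonneg hL ?_
  set B := ∑ i, ∑ j, t i j * ((x i / (2 * (i : ℕ) + 1)) * (x j / (2 * (j : ℕ) + 1))) with hB
  by_cases hB0 : 0 ≤ B
  · nlinarith [h_hi x, mul_le_mul_of_nonneg_right hhi hB0]
  · nlinarith [h_lo x, mul_le_mul_of_nonpos_right hlo (not_le.1 hB0).le]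

end LegendreData

end SpectralCert

end Literature.NumberTheory.ConnesConsani2021

end
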